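/-
Origin: expansion seat `planner-pub-hodgecm-mc-theta-3-g12-0`, handover (CF) 2026-08-20T05:08Z md5 d573c3e263969b611c635df665b65f65 (436 l.; OPTIONAL drop-alone NEW additive leaf over installed (U1) `HodgeCM.Model.ArchLineCenterChar` + binder-2 `HypCensus.LetterSection`/`KappaEigen`/`InsBlock` (all installed RUN 39/40); (J-mu) theta share: closed form of any vacuum-pinned letter character `χ h = ∏_v vacScalar (placeVacExponents … v) (h v)` + `lineCenterChar` as a product of place powers; 4 defs + 22 theorems; rc 0 / 0 warn / trio 21/21; NAME LIST: HodgeCM.Model.ArchSideTerm.character_eq_prod_vacScalar · HodgeCM.Model.ArchSideTerm.centerPair_eq_letterSection · HodgeCM.Model.ArchSideTerm.coe_lineCenterChar_eq_prod_zpow) (`HOME/mc/pub-hodgecm-mc-theta-3-g12/lean/stage41/HodgeCM/Model/ArchLineCenterCharClosedForm.lean`, md5 d573c3e26396, 436 lines);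
landed by the gen-15 packager (p-g15) in gate run 41 as `HodgeCM/Model/ArchLineCenterCharClosedForm.lean` (verbatim).
-/
/-
Origin: speedrun cell pub-hodgecm, MODEL-CONSTRUCTION sub-cell, lineage mc-theta-3 (BINDER-OWNERS row 5, the `𝔄` slot),
seat planner-pub-hodgecm-mc-theta-3-g12-0 (gen 12), 2026-08-20.  Target in PKG: `HodgeCM/Model/ArchLineCenterCharClosedForm.lean`
(NEW additive leaf over the installed `HodgeCM.Model.ArchLineCenterChar` (U1, RUN 40) and binder-2's installed generic letter kit
`HypCensus.LetterSection` (#41, RUN 39) / `HypCensus.KappaEigen` / `HypCensus.InsBlock`).  KERNEL only: 0 records / named facts / proof holes.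
-/
import Summits.HodgeConjecture.HodgeCM.Model.ArchLineCenterChar
import Summits.HodgeConjecture.HodgeCM.Model.HypCensus.LetterSection
import Summits.HodgeConjecture.HodgeCM.Model.HypCensus.KappaEigen
import Summits.HodgeConjecture.HodgeCM.Model.HypCensus.InsBlock

/-!
# The CLOSED FORM of a vacuum-pinned letter character; the centre character of the line datum as a product of place powers

(J-μ) read-off, theta side.  binder-2's compact-letter ENGINE produces, for the CM pin `(V, W) = (diag dV, diag dW)` in any ranks
`N, M` and any frame `e`, ONE continuous character `χ : Π_v K_v →* S¹` of all compact place letters with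
`ω_∞(letterSection h)(follandFock 𝔢 G) = χ h • follandFock 𝔢 (G ∘ letters(h)†)` (`HypCensus.exists_character_letterSection`); it is
CHOSEN (compact rigidity), with no formula.  This leaf computes it:

* §1 **`character_mulSingle_eq_vacScalar`** / **`character_eq_prod_vacScalar`**: ANY `χ` with the vacuum equation
  `ω_∞(letterSection h) Ω = χ h • Ω` (`Ω = follandFock 𝔢 1`) satisfies `χ h = ∏_v vacScalar (e_v) (h v)`, `e_v = placeVacExponents … v`
  binder-2's vacuum exponent tuple of record at `v` (canonical block frame `Equiv.refl`).  Proof: `h = ∏_v mulSingle v (h v)`,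
  `letterSection (mulSingle v k) = letterSectionAt v k = s_v(κ k)` (`cmBlockSectionAt_refl_κ`), the vacuum is the block pure tensor
  `F_v⁻¹(B⁻¹1 ⊠ B⁻¹1)` (`follandFock_one_eq_blockFrame`), and binder-2's single-place kernel `KappaEigen.cmArchWeilRep_κ_binvPi`.
* §2 **`centerPair_eq_letterSection`**: the archimedean centre `(t·1_V, 1)` IS `letterSection (v ↦ centerPlaceLetter v t)` (an archimedean
  pair element is determined by its place components; (F1) `cmPlaceComponent_center`).
* §3 the line `(V, ⟨d⟩)` of (F1): **`lineCenterChar_eq_prod_vacScalar`** and the power form **`coe_lineCenterChar_eq_prod_zpow`**: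
  `lineCenterChar V d hd hd0 hGRd t = ∏_v ι_{w(v)}(t) ^ (|P_v|·e_P(v) + |Q_v|·e_Q(v))`, `P_v ∕ Q_v` the sign blocks of the canonical frame of
  `V` at `v`, `(e_P, e_Q)(v)` the `V`-exponents of `placeVacExponents` of the LINE pair at `v`.  The small-datum hypothesis `hslot` of
  binder-2's `placeVacExponents` (a Weil datum of each block slot exists) is carried as a hypothesis, exactly as in `KappaEigen`.

So the centre eigen-character `c = lineC` of sinst-1's slot-type read-off (`ArchLineSlotType`: `charArchType (slotChiₖ · c)`) is an explicit
integer-power character of the place circles.  Nothing here is a claim of PerL/QW8; nothing is cited as a fact.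
[Folland1989, Prop. (4.39); KonnoKonno2007, Lemma 5.2; Weil1964, Chap. I n° 12.]
-/

set_option autoImplicit false

noncomputable section

open NumberField NumberField.InfinitePlace NumberField.mixedEmbedding IsDedekindDomain
open scoped Matrix Kronecker Classical TensorProduct ComplexConjugate SchwartzMap
open MvPolynomial
open Literature.NumberTheory.Automorphic Literature.NumberTheory.Automorphic.UnitaryGroup Literature.NumberTheory.Weil1964
open Literature.RepresentationTheory.KonnoKonno2007 Literature.RepresentationTheory.KonnoKonno2007.RealDualPair
open Literature.NumberTheory.GelbartRogawski1991 Literature.NumberTheory.GelbartRogawski1991.UnitaryDualPair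
open Literature.Analysis.SegalBargmann
open HodgeCM.Adelic HodgeCM.PerL34 HodgeCM.Model.HypCensus HodgeCM.Model.SupplyInstance

namespace HodgeCM.Model.ArchSideTerm

/-! ## § 0 Relabelling along identity bijections -/

section Relabel

variable {α β : Type} [Fintype α] [DecidableEq α] [Fintype β] [DecidableEq β]

/-- `UForm.relabel` along two identity bijections is the identity. [folklore] -/
theorem UForm_relabel_refl_apply (x : UForm α β) : UForm.relabel α β α β (Equiv.refl α) (Equiv.refl β) x = x := by
  apply Subtype.ext
  apply Units.ext
  rw [UForm.coe_relabel, Equiv.sumCongr_refl, Matrix.reindex_refl_refl]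

variable {γ δ : Type} [Fintype γ] [DecidableEq γ] [Fintype δ] [DecidableEq δ]

/-- `Ginf.relabel` along four identity bijections is the identity. [folklore] -/
theorem Ginf_relabel_refl_apply (g : Ginf α β γ δ) :
    Ginf.relabel α β γ δ α β γ δ (Equiv.refl α) (Equiv.refl β) (Equiv.refl γ) (Equiv.refl δ) g = g := by
  rw [Ginf.relabel_apply, UForm_relabel_refl_apply, UForm_relabel_refl_apply]

/-- … hence so is its inverse. [folklore] -/
theorem Ginf_relabel_refl_symm_apply (g : Ginf α β γ δ) :
    (Ginf.relabel α β γ δ α β γ δ (Equiv.refl α) (Equiv.refl β) (Equiv.refl γ) (Equiv.refl δ)).symm g = g :=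
  (Ginf.relabel α β γ δ α β γ δ (Equiv.refl α) (Equiv.refl β) (Equiv.refl γ) (Equiv.refl δ)).injective
    (by rw [ContinuousMulEquiv.apply_symm_apply, Ginf_relabel_refl_apply])

end Relabel

/-! ## § 1 The closed form of a vacuum-pinned letter character (any ranks `N, M`, any frame `e`) -/

section Generic

variable (L : Type) [Field L] [NumberField L] [IsCMField L] {N M n : ℕ} (e : Fin N × Fin M ≃ Fin n)
variable (dV : Fin N → L) (hdV : ∀ i, IsCMField.complexConj L (dV i) = dV i) (hdV0 : ∀ i, dV i ≠ 0)
variable (dW : Fin M → L) (hdW : ∀ i, IsCMField.complexConj L (dW i) = dW i) (hdW0 : ∀ i, dW i ≠ 0)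
variable (hGR : (cmSplittingDatum L e dV hdV hdV0 dW hdW hdW0).CompatibleSplitting) (ι₁ : L →+* ℂ)

/-- **the letter section at `v` is the block section at `v` in the canonical block frame**:
`s_v (κ k) = letterSectionAt v k` (`cmBlockSectionAt` with the four relabellings `Equiv.refl`). -/
theorem cmBlockSectionAt_refl_κ (v : {v : InfinitePlace ↥(maximalRealSubfield L) // v.IsReal})
    (k : DPK (PosIdx (cmXV L dV hdV ι₁ v)) (NegIdx (cmXV L dV hdV ι₁ v)) (PosIdx (cmXW L dV dW hdW ι₁ v)) (NegIdx (cmXW L dV dW hdW ι₁ v))) :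
    cmBlockSectionAt L dV hdV hdV0 dW hdW hdW0 ι₁ v (Equiv.refl _) (Equiv.refl _) (Equiv.refl _) (Equiv.refl _) (κ _ _ _ _ k) =
      letterSectionAt L dV hdV hdV0 dW hdW hdW0 ι₁ v k := by
  show archPairSection L (IsCMField.complexConj L) N M (IsCMField.complexConj_ne_one L) (cmPlaceOver L) (cmPlaceOver_smul L)
      (cmPlaceOver_comap L) (cmRealVec L dV hdV) (cmRealVec L dW hdW) (realDiagonal_map L dV hdV).symm
      (realDiagonal_map L dW hdW).symm (cmEpsV L dV hdV ι₁) (cmEpsW L dV dW hdW ι₁) (cmDV_ne_zero L dV hdV hdV0 ι₁)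
      (cmDW_ne_zero L dV dW hdW hdW0 ι₁) (cmSignConv_ne_zero L dV ι₁) (cmCW_ne_zero L dV ι₁) (cm_htV L dV hdV hdV0 ι₁)
      (cm_htW L dV dW hdW hdW0 ι₁) (UnitaryGroup.complexConj_smul_infinitePlace L) v
      ((Ginf.relabel (PosIdx (cmXV L dV hdV ι₁ v)) (NegIdx (cmXV L dV hdV ι₁ v)) (PosIdx (cmXW L dV dW hdW ι₁ v))
        (NegIdx (cmXW L dV dW hdW ι₁ v)) _ _ _ _ (Equiv.refl _) (Equiv.refl _) (Equiv.refl _) (Equiv.refl _)).symm (κ _ _ _ _ k)) = _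
  rw [Ginf_relabel_refl_symm_apply, letterSectionAt_apply]

/-- **the vacuum is a block pure tensor at every place**: `follandFock 𝔢 1 = F_v⁻¹ (B⁻¹ 1 ⊠ B⁻¹ 1)` (canonical block frame at `v`). -/
theorem follandFock_one_eq_blockFrame (v : {v : InfinitePlace ↥(maximalRealSubfield L) // v.IsReal}) :
    follandFock (cmBigFrame L e dV hdV hdV0 dW hdW hdW0 ι₁) (1 : MvPolynomial (Fin n × {v : InfinitePlace ↥(maximalRealSubfield L) // v.IsReal}) ℂ) =
      (cmBlockFrameAt L e dV hdV hdV0 dW hdW hdW0 ι₁ v (Equiv.refl _) (Equiv.refl _) (Equiv.refl _) (Equiv.refl _)).symm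
        (tensorPi (binvPi 1) (binvPi 1)) := by
  have h := follandFock_prod_atPlace_eq_symm_tensorPi L e dV hdV hdV0 dW hdW hdW0 ι₁ v (Equiv.refl _) (Equiv.refl _) (Equiv.refl _)
    (Equiv.refl _) (fun _ => (1 : MvPolynomial (Fin n) ℂ))
  simp only [map_one, Finset.prod_const_one] at h
  exact h

variable
  (hsign : (∃ i₀ : Fin N, (∀ i, i ≠ i₀ → 0 < (ι₁ (dV i)).re) ∨ ∀ i, i ≠ i₀ → (ι₁ (dV i)).re < 0) ∧
    ((∀ j, 0 < (ι₁ (dW j)).re) ∨ ∀ j, (ι₁ (dW j)).re < 0) ∧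
    (∀ τ : L →+* ℂ, InfinitePlace.mk τ ≠ InfinitePlace.mk ι₁ → (∀ i, 0 < (τ (dV i)).re) ∨ ∀ i, (τ (dV i)).re < 0) ∧
    (∀ τ : L →+* ℂ, InfinitePlace.mk τ ≠ InfinitePlace.mk ι₁ →
      (∃ j₀ : Fin M, ∀ j, j ≠ j₀ → 0 < (τ (dW j)).re) ∨ ∀ j, (τ (dW j)).re < 0))
  (hslot : ∀ v : {v : InfinitePlace ↥(maximalRealSubfield L) // v.IsReal},
    ∃ ω₁ : Representation ℂ
        (Ginf (PosIdx (cmXV L dV hdV ι₁ v)) (NegIdx (cmXV L dV hdV ι₁ v)) (PosIdx (cmXW L dV dW hdW ι₁ v)) (NegIdx (cmXW L dV dW hdW ι₁ v)))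
        (SchwartzMap (DPIdx (PosIdx (cmXV L dV hdV ι₁ v)) (NegIdx (cmXV L dV hdV ι₁ v)) (PosIdx (cmXW L dV dW hdW ι₁ v))
          (NegIdx (cmXW L dV dW hdW ι₁ v)) → ℝ) ℂ),
      IsArchWeilDatum (ι𝕎 _ _ _ _) ω₁ ∧ ∀ u, Continuous (ω₁ u))

/-- **a vacuum-pinned letter character on a SINGLE letter is binder-2's vacuum scalar**:
`χ (mulSingle v k) = vacScalar (e_v) k`. [Folland1989, Prop. (4.39); KonnoKonno2007, Lemma 5.2] -/
theorem character_mulSingle_eq_vacScalar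
    (χ : (∀ v : {v : InfinitePlace ↥(maximalRealSubfield L) // v.IsReal},
        DPK (PosIdx (cmXV L dV hdV ι₁ v)) (NegIdx (cmXV L dV hdV ι₁ v)) (PosIdx (cmXW L dV dW hdW ι₁ v))
          (NegIdx (cmXW L dV dW hdW ι₁ v))) →* Circle)
    (hχ : ∀ h, cmArchWeilRep L e dV hdV hdV0 dW hdW hdW0 hGR (letterSection L dV hdV hdV0 dW hdW hdW0 ι₁ h)
        (follandFock (cmBigFrame L e dV hdV hdV0 dW hdW hdW0 ι₁) 1) =
      ((χ h : Circle) : ℂ) • follandFock (cmBigFrame L e dV hdV hdV0 dW hdW hdW0 ι₁) 1)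
    (v : {v : InfinitePlace ↥(maximalRealSubfield L) // v.IsReal})
    (k : DPK (PosIdx (cmXV L dV hdV ι₁ v)) (NegIdx (cmXV L dV hdV ι₁ v)) (PosIdx (cmXW L dV dW hdW ι₁ v)) (NegIdx (cmXW L dV dW hdW ι₁ v))) :
    ((χ (Pi.mulSingle v k) : Circle) : ℂ) =
      vacScalar (placeVacExponents L e dV hdV hdV0 dW hdW hdW0 hGR ι₁ v (Equiv.refl _) (Equiv.refl _) (Equiv.refl _) (Equiv.refl _)
        hsign (hslot v)) k := by
  have h1 := hχ (Pi.mulSingle v k)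
  rw [letterSection_mulSingle, ← cmBlockSectionAt_refl_κ, follandFock_one_eq_blockFrame L e dV hdV hdV0 dW hdW hdW0 ι₁ v,
    cmArchWeilRep_κ_binvPi L e dV hdV hdV0 dW hdW hdW0 hGR ι₁ v (Equiv.refl _) (Equiv.refl _) (Equiv.refl _) (Equiv.refl _) hsign
      (hslot v) k, map_one] at h1
  have hΩ : (cmBlockFrameAt L e dV hdV hdV0 dW hdW hdW0 ι₁ v (Equiv.refl _) (Equiv.refl _) (Equiv.refl _) (Equiv.refl _)).symm
      (tensorPi (binvPi (1 : MvPolynomial _ ℂ)) (binvPi (1 : MvPolynomial _ ℂ))) ≠ 0 := by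
    rw [← follandFock_one_eq_blockFrame L e dV hdV hdV0 dW hdW hdW0 ι₁ v]
    exact follandFock_one_ne_zero _
  exact (smul_left_injective ℂ hΩ h1).symm

/-- the closed form as ONE homomorphism `Π_v K_v →* ℂ`, `h ↦ ∏_v vacScalar (e_v) (h v)`, for any family of exponent tuples. -/
def vacScalarPi (ev : {v : InfinitePlace ↥(maximalRealSubfield L) // v.IsReal} → VacExponents) :
    (∀ v : {v : InfinitePlace ↥(maximalRealSubfield L) // v.IsReal},
        DPK (PosIdx (cmXV L dV hdV ι₁ v)) (NegIdx (cmXV L dV hdV ι₁ v)) (PosIdx (cmXW L dV dW hdW ι₁ v))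
          (NegIdx (cmXW L dV dW hdW ι₁ v))) →* ℂ where
  toFun h := ∏ v, vacScalar (ev v) (h v)
  map_one' := by simp only [Pi.one_apply, vacScalar_one, Finset.prod_const_one]
  map_mul' h h' := by simp only [Pi.mul_apply, vacScalar_mul, Finset.prod_mul_distrib]

/-- (Ported verbatim from the HodgeCMPerL package; no docstring in the source.) -/
@[simp] theorem vacScalarPi_apply (ev : {v : InfinitePlace ↥(maximalRealSubfield L) // v.IsReal} → VacExponents)
    (h : ∀ v : {v : InfinitePlace ↥(maximalRealSubfield L) // v.IsReal},
      DPK (PosIdx (cmXV L dV hdV ι₁ v)) (NegIdx (cmXV L dV hdV ι₁ v)) (PosIdx (cmXW L dV dW hdW ι₁ v)) (NegIdx (cmXW L dV dW hdW ι₁ v))) :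
    vacScalarPi L dV hdV dW hdW ι₁ ev h = ∏ v, vacScalar (ev v) (h v) := rfl

/-- (Ported verbatim from the HodgeCMPerL package; no docstring in the source.) -/
theorem vacScalarPi_mulSingle (ev : {v : InfinitePlace ↥(maximalRealSubfield L) // v.IsReal} → VacExponents)
    (v : {v : InfinitePlace ↥(maximalRealSubfield L) // v.IsReal})
    (k : DPK (PosIdx (cmXV L dV hdV ι₁ v)) (NegIdx (cmXV L dV hdV ι₁ v)) (PosIdx (cmXW L dV dW hdW ι₁ v)) (NegIdx (cmXW L dV dW hdW ι₁ v))) :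
    vacScalarPi L dV hdV dW hdW ι₁ ev (Pi.mulSingle v k) = vacScalar (ev v) k := by
  rw [vacScalarPi_apply, Finset.prod_eq_single v (fun b _ hb => by rw [Pi.mulSingle_eq_of_ne hb, vacScalar_one])
    (fun hv => absurd (Finset.mem_univ v) hv), Pi.mulSingle_eq_same]

/-- **THE CLOSED FORM**: a vacuum-pinned letter character is the product over the real places of binder-2's vacuum scalars,
`χ h = ∏_v vacScalar (e_v) (h v)` — as homomorphisms: `coe ∘ χ = vacScalarPi (placeVacExponents)`.
[Folland1989, Prop. (4.39); KonnoKonno2007, Lemma 5.2] -/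
theorem coeHom_comp_character_eq_vacScalarPi
    (χ : (∀ v : {v : InfinitePlace ↥(maximalRealSubfield L) // v.IsReal},
        DPK (PosIdx (cmXV L dV hdV ι₁ v)) (NegIdx (cmXV L dV hdV ι₁ v)) (PosIdx (cmXW L dV dW hdW ι₁ v))
          (NegIdx (cmXW L dV dW hdW ι₁ v))) →* Circle)
    (hχ : ∀ h, cmArchWeilRep L e dV hdV hdV0 dW hdW hdW0 hGR (letterSection L dV hdV hdV0 dW hdW hdW0 ι₁ h)
        (follandFock (cmBigFrame L e dV hdV hdV0 dW hdW hdW0 ι₁) 1) =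
      ((χ h : Circle) : ℂ) • follandFock (cmBigFrame L e dV hdV hdV0 dW hdW hdW0 ι₁) 1) :
    Circle.coeHom.comp χ =
      vacScalarPi L dV hdV dW hdW ι₁ fun v =>
        placeVacExponents L e dV hdV hdV0 dW hdW hdW0 hGR ι₁ v (Equiv.refl _) (Equiv.refl _) (Equiv.refl _) (Equiv.refl _) hsign (hslot v) :=
  MonoidHom.pi_ext fun v k => by
    rw [MonoidHom.comp_apply, Circle.coeHom_apply, vacScalarPi_mulSingle]
    exact character_mulSingle_eq_vacScalar L e dV hdV hdV0 dW hdW hdW0 hGR ι₁ hsign hslot χ hχ v k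

/-- pointwise: `χ h = ∏_v vacScalar (e_v) (h v)`. -/
theorem character_eq_prod_vacScalar
    (χ : (∀ v : {v : InfinitePlace ↥(maximalRealSubfield L) // v.IsReal},
        DPK (PosIdx (cmXV L dV hdV ι₁ v)) (NegIdx (cmXV L dV hdV ι₁ v)) (PosIdx (cmXW L dV dW hdW ι₁ v))
          (NegIdx (cmXW L dV dW hdW ι₁ v))) →* Circle)
    (hχ : ∀ h, cmArchWeilRep L e dV hdV hdV0 dW hdW hdW0 hGR (letterSection L dV hdV hdV0 dW hdW hdW0 ι₁ h)
        (follandFock (cmBigFrame L e dV hdV hdV0 dW hdW hdW0 ι₁) 1) =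
      ((χ h : Circle) : ℂ) • follandFock (cmBigFrame L e dV hdV hdV0 dW hdW hdW0 ι₁) 1)
    (h : ∀ v : {v : InfinitePlace ↥(maximalRealSubfield L) // v.IsReal},
      DPK (PosIdx (cmXV L dV hdV ι₁ v)) (NegIdx (cmXV L dV hdV ι₁ v)) (PosIdx (cmXW L dV dW hdW ι₁ v)) (NegIdx (cmXW L dV dW hdW ι₁ v))) :
    ((χ h : Circle) : ℂ) =
      ∏ v, vacScalar (placeVacExponents L e dV hdV hdV0 dW hdW hdW0 hGR ι₁ v (Equiv.refl _) (Equiv.refl _) (Equiv.refl _) (Equiv.refl _)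
        hsign (hslot v)) (h v) := by
  have h1 := DFunLike.congr_fun (coeHom_comp_character_eq_vacScalarPi L e dV hdV hdV0 dW hdW hdW0 hGR ι₁ hsign hslot χ hχ) h
  rw [MonoidHom.comp_apply, Circle.coeHom_apply, vacScalarPi_apply] at h1
  exact h1

end Generic

/-! ## § 2 The archimedean centre is a value of the letter section -/

section Components

variable (L : Type) [Field L] [NumberField L] [IsCMField L] {N M : ℕ}
variable (dV : Fin N → L) (hdV : ∀ i, IsCMField.complexConj L (dV i) = dV i) (hdV0 : ∀ i, dV i ≠ 0)
variable (dW : Fin M → L) (hdW : ∀ i, IsCMField.complexConj L (dW i) = dW i) (hdW0 : ∀ i, dW i ≠ 0)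
variable (ι₁ : L →+* ℂ)

/-- the restriction of a complex place of `L` to `L⁺` (private copy of binder-2's `cmPlaceUnder`, #50). -/
private abbrev placeUnder (w : {w : InfinitePlace L // w.IsComplex}) : {v : InfinitePlace ↥(maximalRealSubfield L) // v.IsReal} :=
  ⟨w.1.comap (algebraMap ↥(maximalRealSubfield L) L), IsTotallyReal.isReal _⟩

/-- (Ported verbatim from the HodgeCMPerL package; no docstring in the source.) -/
private theorem cmPlaceOver_placeUnder (w : {w : InfinitePlace L // w.IsComplex}) : cmPlaceOver L (placeUnder L w) = w :=
  Subtype.ext ((cmPlaceOver_eq_mk L _ w.1.embedding (by rw [mk_embedding])).trans (mk_embedding w.1))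

/-- the `V`-place component is the Sylvester-framed `w(v)`-component (private copy of binder-2's `cmPlaceComponent_fst`, #50). -/
private theorem cmPlaceComponent_fst' (v : {v : InfinitePlace ↥(maximalRealSubfield L) // v.IsReal})
    (p : UnitaryGroup.arch (↥(maximalRealSubfield L)) L (IsCMField.complexConj L) N (Matrix.diagonal dV) ×
      UnitaryGroup.arch (↥(maximalRealSubfield L)) L (IsCMField.complexConj L) M (Matrix.diagonal dW)) :
    (cmPlaceComponent L dV hdV hdV0 dW hdW hdW0 ι₁ v p).1 =
      toUForm (cmEpsV L dV hdV ι₁ v) (cmDV_ne_zero L dV hdV hdV0 ι₁ v) (cmSignConv_ne_zero L dV ι₁ v)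
        ((formCongr_scaleGL_smul_signForm (cmEpsV L dV hdV ι₁ v) (cmDV_ne_zero L dV hdV hdV0 ι₁ v) (cmSignConv L dV ι₁ v)
            (cm_htV L dV hdV hdV0 ι₁ v)).trans
          (archLocalForm_diagonal L (IsCMField.complexConj L) N (IsCMField.complexConj_ne_one L) (cmPlaceOver L) (cmPlaceOver_smul L)
            (cmPlaceOver_comap L) (cmRealVec L dV hdV) (realDiagonal_map L dV hdV).symm v).symm)
        (archAt (↥(maximalRealSubfield L)) L (IsCMField.complexConj L) N (Matrix.diagonal dV) (cmPlaceOver L v) (cmPlaceOver_smul L v)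
          (IsCMField.complexConj_ne_one L) p.1) := by
  conv_rhs => rw [← archPart_archToAdelic (↥(maximalRealSubfield L)) L (IsCMField.complexConj L) N (Matrix.diagonal dV) p.1]
  rfl

/-- (Ported verbatim from the HodgeCMPerL package; no docstring in the source.) -/
private theorem cmPlaceComponent_snd' (v : {v : InfinitePlace ↥(maximalRealSubfield L) // v.IsReal})
    (p : UnitaryGroup.arch (↥(maximalRealSubfield L)) L (IsCMField.complexConj L) N (Matrix.diagonal dV) ×
      UnitaryGroup.arch (↥(maximalRealSubfield L)) L (IsCMField.complexConj L) M (Matrix.diagonal dW)) :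
    (cmPlaceComponent L dV hdV hdV0 dW hdW hdW0 ι₁ v p).2 =
      toUForm (cmEpsW L dV dW hdW ι₁ v) (cmDW_ne_zero L dV dW hdW hdW0 ι₁ v) (cmCW_ne_zero L dV ι₁ v)
        ((formCongr_scaleGL_smul_signForm (cmEpsW L dV dW hdW ι₁ v) (cmDW_ne_zero L dV dW hdW hdW0 ι₁ v) (cmCW L dV ι₁ v)
            (cm_htW L dV dW hdW hdW0 ι₁ v)).trans
          (archLocalForm_diagonal L (IsCMField.complexConj L) M (IsCMField.complexConj_ne_one L) (cmPlaceOver L) (cmPlaceOver_smul L)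
            (cmPlaceOver_comap L) (cmRealVec L dW hdW) (realDiagonal_map L dW hdW).symm v).symm)
        (archAt (↥(maximalRealSubfield L)) L (IsCMField.complexConj L) M (Matrix.diagonal dW) (cmPlaceOver L v) (cmPlaceOver_smul L v)
          (IsCMField.complexConj_ne_one L) p.2) := by
  conv_rhs => rw [← archPart_archToAdelic (↥(maximalRealSubfield L)) L (IsCMField.complexConj L) M (Matrix.diagonal dW) p.2]
  rfl

/-- **an archimedean pair element is determined by its place components** (private copy of binder-2's `eq_of_cmPlaceComponent_eq`, #50). -/
theorem eq_of_cmPlaceComponent_eq'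
    {p q : UnitaryGroup.arch (↥(maximalRealSubfield L)) L (IsCMField.complexConj L) N (Matrix.diagonal dV) ×
      UnitaryGroup.arch (↥(maximalRealSubfield L)) L (IsCMField.complexConj L) M (Matrix.diagonal dW)}
    (h : ∀ v, cmPlaceComponent L dV hdV hdV0 dW hdW hdW0 ι₁ v p = cmPlaceComponent L dV hdV hdV0 dW hdW hdW0 ι₁ v q) : p = q := by
  refine Prod.ext ?_ ?_
  · apply (archPiEquiv (↥(maximalRealSubfield L)) L (IsCMField.complexConj L) N (Matrix.diagonal dV) (IsCMField.complexConj_ne_one L)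
      (UnitaryGroup.complexConj_smul_infinitePlace L)).injective
    funext w
    rw [archPiEquiv_apply, archPiEquiv_apply, ← cmPlaceOver_placeUnder L w]
    have h1 := congrArg Prod.fst (h (placeUnder L w))
    rw [cmPlaceComponent_fst', cmPlaceComponent_fst'] at h1
    exact (toUForm_bijective _ _ _ _).1 h1
  · apply (archPiEquiv (↥(maximalRealSubfield L)) L (IsCMField.complexConj L) M (Matrix.diagonal dW) (IsCMField.complexConj_ne_one L)
      (UnitaryGroup.complexConj_smul_infinitePlace L)).injective
    funext w
    rw [archPiEquiv_apply, archPiEquiv_apply, ← cmPlaceOver_placeUnder L w]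
    have h2 := congrArg Prod.snd (h (placeUnder L w))
    rw [cmPlaceComponent_snd', cmPlaceComponent_snd'] at h2
    exact (toUForm_bijective _ _ _ _).1 h2

/-- **the archimedean centre is a value of the letter section**: `(t·1_V, 1) = letterSection (v ↦ centerPlaceLetter v t)`. -/
theorem centerPair_eq_letterSection (t : ↥(Literature.NumberTheory.Automorphic.relNormOneInfUnits (↥(maximalRealSubfield L)) L)) :
    ((cmArchCenter L N (Matrix.diagonal dV) t, 1) :
        UnitaryGroup.arch (↥(maximalRealSubfield L)) L (IsCMField.complexConj L) N (Matrix.diagonal dV) ×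
          UnitaryGroup.arch (↥(maximalRealSubfield L)) L (IsCMField.complexConj L) M (Matrix.diagonal dW)) =
      letterSection L dV hdV hdV0 dW hdW hdW0 ι₁ (fun v => centerPlaceLetter L dV hdV dW hdW ι₁ v t) :=
  eq_of_cmPlaceComponent_eq' L dV hdV hdV0 dW hdW hdW0 ι₁ fun v => by
    rw [cmPlaceComponent_center, cmPlaceComponent_letterSection]

/-- the centre letters as ONE homomorphism into all letters: `t ↦ (v ↦ centerPlaceLetter v t)`. -/
def centerLetters :
    ↥(Literature.NumberTheory.Automorphic.relNormOneInfUnits (↥(maximalRealSubfield L)) L) →*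
      ∀ v : {v : InfinitePlace ↥(maximalRealSubfield L) // v.IsReal},
        DPK (PosIdx (cmXV L dV hdV ι₁ v)) (NegIdx (cmXV L dV hdV ι₁ v)) (PosIdx (cmXW L dV dW hdW ι₁ v)) (NegIdx (cmXW L dV dW hdW ι₁ v)) :=
  MonoidHom.pi fun v => centerPlaceLetter L dV hdV dW hdW ι₁ v

/-- (Ported verbatim from the HodgeCMPerL package; no docstring in the source.) -/
@[simp] theorem centerLetters_apply (t : ↥(Literature.NumberTheory.Automorphic.relNormOneInfUnits (↥(maximalRealSubfield L)) L))
    (v : {v : InfinitePlace ↥(maximalRealSubfield L) // v.IsReal}) :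
    centerLetters L dV hdV dW hdW ι₁ t v = centerPlaceLetter L dV hdV dW hdW ι₁ v t := rfl

/-- `centerPairHom = letterSection ∘ centerLetters`. -/
theorem centerPairHom_eq_letterSection_comp :
    centerPairHom L dV dW = (letterSection L dV hdV hdV0 dW hdW hdW0 ι₁).comp (centerLetters L dV hdV dW hdW ι₁) := by
  ext1 t
  rw [centerPairHom_apply, MonoidHom.comp_apply]
  exact centerPair_eq_letterSection L dV hdV hdV0 dW hdW hdW0 ι₁ t

/-- **the `V`-blocks of a centre letter are the scalar `ι_{w(v)}(t)`** and its `W`-blocks are trivial. -/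
theorem coe_centerPlaceLetter_fst_fst (v : {v : InfinitePlace ↥(maximalRealSubfield L) // v.IsReal})
    (t : ↥(Literature.NumberTheory.Automorphic.relNormOneInfUnits (↥(maximalRealSubfield L)) L)) :
    (((centerPlaceLetter L dV hdV dW hdW ι₁ v t).1.1 : Matrix.unitaryGroup (PosIdx (cmXV L dV hdV ι₁ v)) ℂ) :
        Matrix (PosIdx (cmXV L dV hdV ι₁ v)) (PosIdx (cmXV L dV hdV ι₁ v)) ℂ) =
      ((NumberField.archPlaceChar L (cmPlaceOver L v).1 t : Circle) : ℂ) • (1 : Matrix _ _ ℂ) := by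
  rw [centerPlaceLetter_fst, coe_diagHom, Matrix.smul_one_eq_diagonal]
  rfl

/-- (Ported verbatim from the HodgeCMPerL package; no docstring in the source.) -/
theorem coe_centerPlaceLetter_fst_snd (v : {v : InfinitePlace ↥(maximalRealSubfield L) // v.IsReal})
    (t : ↥(Literature.NumberTheory.Automorphic.relNormOneInfUnits (↥(maximalRealSubfield L)) L)) :
    (((centerPlaceLetter L dV hdV dW hdW ι₁ v t).1.2 : Matrix.unitaryGroup (NegIdx (cmXV L dV hdV ι₁ v)) ℂ) :
        Matrix (NegIdx (cmXV L dV hdV ι₁ v)) (NegIdx (cmXV L dV hdV ι₁ v)) ℂ) =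
      ((NumberField.archPlaceChar L (cmPlaceOver L v).1 t : Circle) : ℂ) • (1 : Matrix _ _ ℂ) := by
  rw [centerPlaceLetter_fst, coe_diagHom, Matrix.smul_one_eq_diagonal]
  rfl

end Components

/-! ## § 3 The centre character of the line datum, closed form -/

section Line

variable {L : CMField} {ι₁ : L →+* ℂ} (V : HermSpace3 L ι₁)
variable (d : (L : Type)) (hd : IsCMField.complexConj L d = d) (hd0 : d ≠ 0)
  (hGRd : (cmSplittingDatum (L : Type) (e₁) (frameD V) (frameD_real V) (frameD_ne V) (lineVec (L : Type) d) (fun _ => hd)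
    (fun _ => hd0)).CompatibleSplitting)

include hd hd0 in
/-- the four sign facts of the line pair `(V, ⟨d⟩)` bundled as binder-2's `hsign` ((F1) § 0: `frameD_sign_ι₁'`, `lineVec_sign`,
`frameD_sign_of_ne`, `lineVec_sign_of_ne`). -/
theorem line_hsign :
    (∃ i₀ : Fin 3, (∀ i, i ≠ i₀ → 0 < (ι₁ (frameD V i)).re) ∨ ∀ i, i ≠ i₀ → (ι₁ (frameD V i)).re < 0) ∧
      ((∀ j, 0 < (ι₁ (lineVec (L : Type) d j)).re) ∨ ∀ j, (ι₁ (lineVec (L : Type) d j)).re < 0) ∧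
      (∀ τ : (L : Type) →+* ℂ, InfinitePlace.mk τ ≠ InfinitePlace.mk ι₁ →
        (∀ i, 0 < (τ (frameD V i)).re) ∨ ∀ i, (τ (frameD V i)).re < 0) ∧
      (∀ τ : (L : Type) →+* ℂ, InfinitePlace.mk τ ≠ InfinitePlace.mk ι₁ →
        (∃ j₀ : Fin 1, ∀ j, j ≠ j₀ → 0 < (τ (lineVec (L : Type) d j)).re) ∨ ∀ j, (τ (lineVec (L : Type) d j)).re < 0) :=
  ⟨frameD_sign_ι₁' V, lineVec_sign (L : Type) ι₁ d hd hd0, frameD_sign_of_ne V, fun τ hτ => lineVec_sign_of_ne (L : Type) ι₁ d τ hτ⟩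

variable
  (hslot : ∀ v : {v : InfinitePlace ↥(maximalRealSubfield L) // v.IsReal},
    ∃ ω₁ : Representation ℂ
        (Ginf (PosIdx (cmXV (L : Type) (frameD V) (frameD_real V) ι₁ v)) (NegIdx (cmXV (L : Type) (frameD V) (frameD_real V) ι₁ v))
          (PosIdx (cmXW (L : Type) (frameD V) (lineVec (L : Type) d) (fun _ => hd) ι₁ v))
          (NegIdx (cmXW (L : Type) (frameD V) (lineVec (L : Type) d) (fun _ => hd) ι₁ v)))
        (SchwartzMap (DPIdx (PosIdx (cmXV (L : Type) (frameD V) (frameD_real V) ι₁ v)) (NegIdx (cmXV (L : Type) (frameD V) (frameD_real V) ι₁ v))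
          (PosIdx (cmXW (L : Type) (frameD V) (lineVec (L : Type) d) (fun _ => hd) ι₁ v))
          (NegIdx (cmXW (L : Type) (frameD V) (lineVec (L : Type) d) (fun _ => hd) ι₁ v)) → ℝ) ℂ),
      IsArchWeilDatum (ι𝕎 _ _ _ _) ω₁ ∧ ∀ u, Continuous (ω₁ u))

/-- **the vacuum exponent tuple of the line pair at `v`** (binder-2's `placeVacExponents` of `(V, ⟨d⟩)`, canonical block frame). -/
def lineVacExponents (v : {v : InfinitePlace ↥(maximalRealSubfield L) // v.IsReal}) : VacExponents :=
  placeVacExponents (L : Type) e₁ (frameD V) (frameD_real V) (frameD_ne V) (lineVec (L : Type) d) (fun _ => hd) (fun _ => hd0) hGRd ι₁ v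
    (Equiv.refl _) (Equiv.refl _) (Equiv.refl _) (Equiv.refl _) (line_hsign V d hd hd0) (hslot v)

/-- the letter character of the line pair (chosen from binder-2's `exists_character_letterSection`; private — only its closed form is used). -/
private def lineLetterChar :
    (∀ v : {v : InfinitePlace ↥(maximalRealSubfield L) // v.IsReal},
        DPK (PosIdx (cmXV (L : Type) (frameD V) (frameD_real V) ι₁ v)) (NegIdx (cmXV (L : Type) (frameD V) (frameD_real V) ι₁ v))
          (PosIdx (cmXW (L : Type) (frameD V) (lineVec (L : Type) d) (fun _ => hd) ι₁ v))
          (NegIdx (cmXW (L : Type) (frameD V) (lineVec (L : Type) d) (fun _ => hd) ι₁ v))) →* Circle :=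
  (exists_character_letterSection (L : Type) e₁ (frameD V) (frameD_real V) (frameD_ne V) (lineVec (L : Type) d) (fun _ => hd)
    (fun _ => hd0) hGRd ι₁ (frameD_sign_ι₁' V) (lineVec_sign (L : Type) ι₁ d hd hd0) (frameD_sign_of_ne V)
    (fun τ hτ => lineVec_sign_of_ne (L : Type) ι₁ d τ hτ)).choose

/-- (Ported verbatim from the HodgeCMPerL package; no docstring in the source.) -/
private theorem lineLetterChar_vacuum
    (h : ∀ v : {v : InfinitePlace ↥(maximalRealSubfield L) // v.IsReal},
        DPK (PosIdx (cmXV (L : Type) (frameD V) (frameD_real V) ι₁ v)) (NegIdx (cmXV (L : Type) (frameD V) (frameD_real V) ι₁ v))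
          (PosIdx (cmXW (L : Type) (frameD V) (lineVec (L : Type) d) (fun _ => hd) ι₁ v))
          (NegIdx (cmXW (L : Type) (frameD V) (lineVec (L : Type) d) (fun _ => hd) ι₁ v))) :
    cmArchWeilRep (L : Type) e₁ (frameD V) (frameD_real V) (frameD_ne V) (lineVec (L : Type) d) (fun _ => hd) (fun _ => hd0) hGRd
        (letterSection (L : Type) (frameD V) (frameD_real V) (frameD_ne V) (lineVec (L : Type) d) (fun _ => hd) (fun _ => hd0) ι₁ h)
        (follandFock (cmBigFrame (L : Type) e₁ (frameD V) (frameD_real V) (frameD_ne V) (lineVec (L : Type) d) (fun _ => hd)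
          (fun _ => hd0) ι₁) 1) =
      ((lineLetterChar V d hd hd0 hGRd h : Circle) : ℂ) •
        follandFock (cmBigFrame (L : Type) e₁ (frameD V) (frameD_real V) (frameD_ne V) (lineVec (L : Type) d) (fun _ => hd)
          (fun _ => hd0) ι₁) 1 := by
  have h' := (exists_character_letterSection (L : Type) e₁ (frameD V) (frameD_real V) (frameD_ne V) (lineVec (L : Type) d) (fun _ => hd)
    (fun _ => hd0) hGRd ι₁ (frameD_sign_ι₁' V) (lineVec_sign (L : Type) ι₁ d hd hd0) (frameD_sign_of_ne V)
    (fun τ hτ => lineVec_sign_of_ne (L : Type) ι₁ d τ hτ)).choose_spec.2 h 1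
  rw [map_one] at h'
  exact h'

/-- **`lineCenterChar` IS the letter character on the centre letters** ((U1) `lineCenterChar_eq_of_vacuum`). -/
private theorem lineCenterChar_eq_lineLetterChar_comp :
    lineCenterChar V d hd hd0 hGRd =
      (lineLetterChar V d hd hd0 hGRd).comp (centerLetters (L : Type) (frameD V) (frameD_real V) (lineVec (L : Type) d) (fun _ => hd) ι₁) :=
  (lineCenterChar_eq_of_vacuum V d hd hd0 hGRd _ fun t => by
    have hc : ((cmArchCenter (L : Type) 3 (Matrix.diagonal (frameD V)) t, 1) :
          UnitaryGroup.arch (↥(maximalRealSubfield L)) (L : Type) (IsCMField.complexConj L) 3 (Matrix.diagonal (frameD V)) ×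
            UnitaryGroup.arch (↥(maximalRealSubfield L)) (L : Type) (IsCMField.complexConj L) 1 (Matrix.diagonal (lineVec (L : Type) d))) =
        letterSection (L : Type) (frameD V) (frameD_real V) (frameD_ne V) (lineVec (L : Type) d) (fun _ => hd) (fun _ => hd0) ι₁
          (centerLetters (L : Type) (frameD V) (frameD_real V) (lineVec (L : Type) d) (fun _ => hd) ι₁ t) :=
      centerPair_eq_letterSection (L : Type) (frameD V) (frameD_real V) (frameD_ne V) (lineVec (L : Type) d) (fun _ => hd)
        (fun _ => hd0) ι₁ t
    rw [MonoidHom.comp_apply, ← lineLetterChar_vacuum, ← hc]).symm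

/-- **CLOSED FORM of the centre character of the line datum**: `lineCenterChar t = ∏_v vacScalar (e_v) (centerPlaceLetter v t)`. -/
theorem coe_lineCenterChar_eq_prod_vacScalar (t : ↥(Literature.NumberTheory.Automorphic.relNormOneInfUnits (↥(maximalRealSubfield L)) L)) :
    ((lineCenterChar V d hd hd0 hGRd t : Circle) : ℂ) =
      ∏ v, vacScalar (lineVacExponents V d hd hd0 hGRd hslot v)
        (centerPlaceLetter (L : Type) (frameD V) (frameD_real V) (lineVec (L : Type) d) (fun _ => hd) ι₁ v t) := by
  rw [lineCenterChar_eq_lineLetterChar_comp, MonoidHom.comp_apply]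
  exact character_eq_prod_vacScalar (L : Type) e₁ (frameD V) (frameD_real V) (frameD_ne V) (lineVec (L : Type) d) (fun _ => hd)
    (fun _ => hd0) hGRd ι₁ (line_hsign V d hd hd0) hslot _ (lineLetterChar_vacuum V d hd hd0 hGRd) _

/-- **CLOSED FORM, power shape**: `lineCenterChar t = ∏_v ι_{w(v)}(t) ^ (|P_v|·e_P(v) + |Q_v|·e_Q(v))`. -/
theorem coe_lineCenterChar_eq_prod_zpow (t : ↥(Literature.NumberTheory.Automorphic.relNormOneInfUnits (↥(maximalRealSubfield L)) L)) :
    ((lineCenterChar V d hd hd0 hGRd t : Circle) : ℂ) =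
      ∏ v : {v : InfinitePlace ↥(maximalRealSubfield L) // v.IsReal},
        ((NumberField.archPlaceChar (L : Type) (cmPlaceOver (L : Type) v).1 t : Circle) : ℂ) ^
          ((Fintype.card (PosIdx (cmXV (L : Type) (frameD V) (frameD_real V) ι₁ v)) : ℤ) * (lineVacExponents V d hd hd0 hGRd hslot v).eP +
            (Fintype.card (NegIdx (cmXV (L : Type) (frameD V) (frameD_real V) ι₁ v)) : ℤ) * (lineVacExponents V d hd hd0 hGRd hslot v).eQ) := by
  rw [coe_lineCenterChar_eq_prod_vacScalar V d hd hd0 hGRd hslot]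
  refine Finset.prod_congr rfl fun v _ => ?_
  rw [vacScalar_of_V_blocks_eq_smul_one (lineVacExponents V d hd hd0 hGRd hslot v)
    (coe_centerPlaceLetter_fst_fst (L : Type) (frameD V) (frameD_real V) (lineVec (L : Type) d) (fun _ => hd) ι₁ v t)
    (coe_centerPlaceLetter_fst_snd (L : Type) (frameD V) (frameD_real V) (lineVec (L : Type) d) (fun _ => hd) ι₁ v t)
    (centerPlaceLetter_snd (L : Type) (frameD V) (frameD_real V) (lineVec (L : Type) d) (fun _ => hd) ι₁ v t),
    ← zpow_add₀ (Circle.coe_ne_zero _)]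

/-- the same for (F1)'s `lineC = (lineCenterChar : ℂ) · ι_{w(v₁)}` (the extra factor is the `W`-centre letter at `v₁`). -/
theorem lineC_eq_prod_zpow_mul (t : ↥(Literature.NumberTheory.Automorphic.relNormOneInfUnits (↥(maximalRealSubfield L)) L)) :
    lineC V d hd hd0 hGRd t =
      (∏ v : {v : InfinitePlace ↥(maximalRealSubfield L) // v.IsReal},
        ((NumberField.archPlaceChar (L : Type) (cmPlaceOver (L : Type) v).1 t : Circle) : ℂ) ^
          ((Fintype.card (PosIdx (cmXV (L : Type) (frameD V) (frameD_real V) ι₁ v)) : ℤ) * (lineVacExponents V d hd hd0 hGRd hslot v).eP +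
            (Fintype.card (NegIdx (cmXV (L : Type) (frameD V) (frameD_real V) ι₁ v)) : ℤ) * (lineVacExponents V d hd hd0 hGRd hslot v).eQ)) *
        ((NumberField.archPlaceChar (L : Type) (cmPlaceOver (L : Type) (HypCensus.cmPlace (L : Type) ι₁)).1 t : Circle) : ℂ) := by
  rw [lineC_def, coe_lineCenterChar_eq_prod_zpow V d hd hd0 hGRd hslot t]

end Line

end HodgeCM.Model.ArchSideTerm

end
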